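import Literature.NumberTheory.ComplexMultiplication.EllipticUnits.ImaginaryQuadraticMainConjectureCarriers
import Literature.NumberTheory.GaloisRepresentations.ArtinReciprocityPerPrime
import HarnessLib

/-!
# Kato's ray-class tower `K(p^s𝔣)`: monotonicity and RESTRICTION-COMPATIBILITY of the lifted Artin
# symbols `(𝔞, K(p^s𝔣)/K)` across `s` — PROVED (no named fact)

Topic `NumberTheory/ComplexMultiplication/EllipticUnits`; namespace
`Literature.NumberTheory.ComplexMultiplication.EllipticUnits`. Cell `bsd-print-cf2`
(`run/shared/lean/pub/bsd-print-cf2/`), width seat `bsd-line-cf2-p1-w2` g17, `--supports` the deciding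
child stmt-BirchSwinnertonDyer-24721 of crux 20368. THEOREMS ONLY (no `def`, no named fact, no `sorry`).
First of two files; the sequel `KatoLayerArtinExponents.lean` builds the `(γ₁, γ₂)`-exponents of
`σ_𝔞 = (𝔞, K̃_∞/K)` (the Artin half (A1) of Johnson-Leung–Kings' pinned datum) on it.

The tree's `KatoEllipticZetaElement.lean` (Kato 2004 §15.1/15.6) defines the layers
`katoLayer p 𝔣 s = K(p^s𝔣)` (idelic ray class fields), the lift `layerLift` of a layer automorphism
to `Γ_K` (Mathlib `AlgEquiv.liftNormal`, a CHOICE) and the lifted Artin symbol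
`layerArtin p 𝔣 s 𝔞 = lift of (𝔞, K(p^s𝔣)/K) = ∏_𝔮 Frob_𝔮^{v_𝔮(𝔞)}`; the tree's
`ImaginaryQuadraticMainConjectureCarriers.lean` (Johnson-Leung–Kings 2011 §5.1) PINS, in its hypothesis
structure `TwistedIwasawaData`, exponent maps `artin₁ artin₂` by the clause (A1) `artin_spec`
"`γ₁^{x₁ mod pⁿ} γ₂^{x₂ mod pⁿ} (layerArtin p 𝔣 s 𝔞)⁻¹ ∈ Gal(K̄/K̃_n)` for all large `s` whenever
`K̃_n ⊆ K(p^s𝔣)`", which presupposes that Kato's lifts form a COMPATIBLE SYSTEM modulo the level subgroups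
(Kato §15.6: "`(𝔞, K(p^∞𝔣)/K) ∈ G_{p^∞𝔣}`"). This file PROVES that:

* §1 `katoModulus_anti`, **`katoLayer_mono`** (`K(p^s𝔣) ⊆ K(p^{s′}𝔣)` for `s ≤ s′`, Neukirch VI (6.2):
  `𝔪 ∣ 𝔪′ ⇒ K^𝔪 ⊆ K^{𝔪′}`), **`katoLevelSubgroup_antitone`**, and that admissible twists (prime to
  `6p𝔣`) are prime to `p𝔣`, hence their prime factors do not divide any `p^s𝔣`;
* §2 `absRestrictNormalHom_layerLift` (restriction ∘ lift = id), `map_artinSymbol`,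
  `artinSymbol_congr_of_dvd`, and — for ABSTRACT finite abelian `E ≤ E′ ⊆ K̄` (where the kernel check of
  the local `Algebra E E′` structure is cheap) — **`coe_galFrob_inclusion_eq`** /
  **`coe_artinSymbol_galFrob_inclusion_eq`**: Frobenius and Artin symbols of `E′` RESTRICT to those of
  `E` at primes unramified in `E` (Childress Ch. 5 §1 Cor. 1.2 "`(𝔭, K/F)|_L = (𝔭, L/F)`" prime by prime,
  the tree's `restrictNormalHom_galFrob_eq_galFrob_of_isUnramifiedIn`); specialised to the tower:
  **`absRestrictNormalHom_layerArtin_of_le`** `(layerArtin p 𝔣 s′ 𝔞)|_{K(p^s𝔣)} = (𝔞, K(p^s𝔣)/K)` and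
  **`layerArtin_inv_mul_layerArtin_mem`**: `(layerArtin p 𝔣 s 𝔞)⁻¹ · layerArtin p 𝔣 s′ 𝔞 ∈ Gal(K̄/K(p^s𝔣))`
  for `s ≤ s′` and `𝔞` prime to `p𝔣` (every `𝔮 ∣ 𝔞` is unramified in the ray class field of a modulus
  it does not divide, `isUnramifiedIn_rayClassField`).

HONEST FRAMING: Galois bookkeeping on Kato's tower; nothing here is about an elliptic curve; BSD is not
advanced.

## References
* [Kato2004Asterisque] K. Kato, Astérisque 295 (2004), §15.1 (p. 250: `K(p^∞𝔣) = ∪_n K(pⁿ𝔣)`),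
  §15.6 (p. 254: "`(𝔞, K(p^∞𝔣)/K) ∈ G_{p^∞𝔣}`", "`𝔞` prime to `6p𝔣`").
* [JohnsonLeungKings2011] J. Johnson-Leung, G. Kings, J. reine angew. Math. 653 (2011), §5.1
  (arXiv:0804.2828 p0014:L12–14: "`σ_𝔞 := (𝔞, K_∞/K)`"), Def. 3.2 (p0009:L55–70: the levels `K(p^s𝔣)`).
* [Childress2009] N. Childress, *Class Field Theory* (2009), Ch. 5 §1 Cor. 1.2 (PDF p. 115).
* [NeukirchANT1999] J. Neukirch, *Algebraic Number Theory* (1999), Ch. I §2 (norms of integers),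
  Ch. IV §1, Ch. VI §1 Def. (1.7), §6 Def. (6.2), §7 (7.3).
-/

noncomputable section

open scoped Classical
open Field NumberField IsDedekindDomain
open Literature.NumberTheory.NumberFields (rayClassField rayUnitIdeles mem_rayUnitIdeles_iff rayClassField_mono
  isUnramifiedIn_rayClassField)
open Literature.NumberTheory.GaloisRepresentations
open Literature.NumberTheory.LFunctions.AbelianDensity (artinSymbol mulSupport_artinSymbol_finite)
open Literature.NumberTheory.EllipticCurves

namespace Literature.NumberTheory.ComplexMultiplication.EllipticUnits

variable {K : Type} [Field K] [NumberField K] (p : ℕ) (𝔣 : Ideal (𝓞 K))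

/-! ## §1. The tower `K(p^s𝔣)` is increasing; the level subgroups `Gal(K̄/K(p^s𝔣))` are decreasing -/

omit [NumberField K] in
/-- `p^{s′}𝔣 ⊆ p^s𝔣` for `s ≤ s′` (as ideals: `p^s𝔣 ∣ p^{s′}𝔣`). [cite: Kato2004Asterisque, §15.1 (p. 250)] -/
theorem katoModulus_anti {s s' : ℕ} (h : s ≤ s') : katoModulus p 𝔣 s' ≤ katoModulus p 𝔣 s :=
  Ideal.mul_mono_left (Ideal.pow_le_pow_right h)

omit [NumberField K] in
/-- `p^s𝔣 ⊆ (p)^s`. [cite: Kato2004Asterisque, §15.1 (p. 250)] -/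
theorem katoModulus_le_span_pow (s : ℕ) :
    katoModulus p 𝔣 s ≤ Ideal.span {((p : ℕ) : 𝓞 K)} ^ s :=
  Ideal.mul_le_right

/-- `(p) ≠ 0` in `𝓞 K` for a prime `p`. [cite: Kato2004Asterisque, §15.1 (p. 250)] -/
theorem span_natCast_prime_ne_bot [Fact p.Prime] :
    (Ideal.span {((p : ℕ) : 𝓞 K)} : Ideal (𝓞 K)) ≠ ⊥ := by
  rw [Ne, Ideal.span_singleton_eq_bot]
  exact_mod_cast (Fact.out : p.Prime).ne_zero

/-- `p^s𝔣 ≠ 0` for `𝔣 ≠ 0`. [cite: Kato2004Asterisque, §15.1 (p. 250)] -/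
theorem katoModulus_ne_bot [Fact p.Prime] (h𝔣 : 𝔣 ≠ ⊥) (s : ℕ) : katoModulus p 𝔣 s ≠ ⊥ := by
  rw [katoModulus]
  exact mul_ne_zero (pow_ne_zero _ (span_natCast_prime_ne_bot p)) h𝔣

/-- `W_𝔪` is antitone in the modulus: `𝔪′ ≤ 𝔪`, `𝔪′ ≠ 0` give `W_{𝔪′} ≤ W_𝔪` (the private lemma of the
tree's `DeShalit1987.RayClassTower`, re-proved for export). [cite: NeukirchANT1999, Ch. VI §1 Def. (1.7)] -/
theorem rayUnitIdeles_anti_of_le {𝔪 𝔪' : Ideal (𝓞 K)} (h𝔪' : 𝔪' ≠ ⊥) (h : 𝔪' ≤ 𝔪) :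
    rayUnitIdeles K 𝔪' ≤ rayUnitIdeles K 𝔪 := by
  intro x hx
  rw [mem_rayUnitIdeles_iff] at hx ⊢
  intro v
  refine ⟨(hx v).1, (hx v).2.trans ?_⟩
  rw [WithZero.exp_le_exp, neg_le_neg_iff]
  exact FractionalIdeal.count_mono K v (FractionalIdeal.coeIdeal_ne_zero.2 h𝔪')
    ((FractionalIdeal.coeIdeal_le_coeIdeal K).2 h)

/-- **The ray-class tower is increasing: `K(p^s𝔣) ⊆ K(p^{s′}𝔣)` for `s ≤ s′`** ("`K(p^∞𝔣) = ∪_n K(pⁿ𝔣)`";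
Neukirch VI (6.2): `𝔪 ∣ 𝔪′ ⇒ K^𝔪 ⊆ K^{𝔪′}`). [cite: Kato2004Asterisque, §15.1 (p. 250)]
[cite: NeukirchANT1999, Ch. VI §6 Def. (6.2)] -/
theorem katoLayer_mono [Fact p.Prime] (h𝔣 : 𝔣 ≠ ⊥) : Monotone (katoLayer p 𝔣) := fun _ s' h ↦
  rayClassField_mono (rayUnitIdeles_anti_of_le (katoModulus_ne_bot p 𝔣 h𝔣 s') (katoModulus_anti p 𝔣 h))

/-- **The level subgroups decrease: `Gal(K̄/K(p^{s′}𝔣)) ≤ Gal(K̄/K(p^s𝔣))` for `s ≤ s′`.**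
[cite: Kato2004Asterisque, §15.1 (p. 250)] [cite: JohnsonLeungKings2011, Def. 3.2 (arXiv p0009:L55–70)] -/
theorem katoLevelSubgroup_antitone [Fact p.Prime] (h𝔣 : 𝔣 ≠ ⊥) :
    Antitone (JohnsonLeungKings2011.katoLevelSubgroup p 𝔣) := by
  intro s s' h σ hσ
  rw [mem_absGaloisFixingSubgroup_iff] at hσ ⊢
  exact fun x hx ↦ hσ x (katoLayer_mono p 𝔣 h𝔣 h hx)

/-! ## §2. Restriction of the lifted Artin symbols -/

/-- **Restriction ∘ Kato's lift = identity**: `(layerLift τ)|_{K(p^s𝔣)} = τ`.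
[cite: Kato2004Asterisque, §15.1 (p. 250)] -/
theorem absRestrictNormalHom_layerLift (s : ℕ) (τ : katoLayer p 𝔣 s ≃ₐ[K] katoLayer p 𝔣 s) :
    absRestrictNormalHom (katoLayer p 𝔣 s) (layerLift p 𝔣 s τ) = τ := by
  refine AlgEquiv.ext fun x ↦ Subtype.ext ?_
  have h1 : ((absRestrictNormalHom (katoLayer p 𝔣 s) (layerLift p 𝔣 s τ) x : katoLayer p 𝔣 s) :
      AlgebraicClosure K) = layerLift p 𝔣 s τ • (x : AlgebraicClosure K) :=
    AlgEquiv.restrictNormalHom_apply _ _ x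
  rw [h1, layerLift_smul]

/-- **`(layerArtin p 𝔣 s 𝔞)|_{K(p^s𝔣)} = (𝔞, K(p^s𝔣)/K)`** — the lift restricts to the Artin symbol it lifts.
[cite: Kato2004Asterisque, §15.6 (p. 254)] -/
theorem absRestrictNormalHom_layerArtin_self (s : ℕ) (𝔞 : Ideal (𝓞 K)) :
    absRestrictNormalHom (katoLayer p 𝔣 s) (layerArtin p 𝔣 s 𝔞) =
      artinSymbol (galFrob K (katoLayer p 𝔣 s)) 𝔞 :=
  absRestrictNormalHom_layerLift p 𝔣 s _

/-- A monoid homomorphism passes through the Artin symbol: `φ(∏ f(𝔮)^{v_𝔮(𝔞)}) = ∏ φ(f 𝔮)^{v_𝔮(𝔞)}`.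
[cite: Childress2009, Ch. 5 §1 Cor. 1.2 (PDF p. 115)] -/
theorem map_artinSymbol {G H : Type*} [CommGroup G] [CommGroup H] (φ : G →* H)
    (f : HeightOneSpectrum (𝓞 K) → G) {I : Ideal (𝓞 K)} (hI : I ≠ ⊥) :
    φ (artinSymbol f I) = artinSymbol (φ ∘ f) I := by
  unfold artinSymbol
  rw [MonoidHom.map_finprod φ (mulSupport_artinSymbol_finite f hI)]
  refine finprod_congr fun v ↦ ?_
  rw [map_pow, Function.comp_apply]

/-- The Artin symbol of `𝔞 ≠ 0` only sees the values of `f` at the primes DIVIDING `𝔞`.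
[cite: Childress2009, Ch. 5 §1 Cor. 1.2 (PDF p. 115)] -/
theorem artinSymbol_congr_of_dvd {G : Type*} [CommGroup G] {f g : HeightOneSpectrum (𝓞 K) → G}
    {I : Ideal (𝓞 K)} (hI : I ≠ ⊥) (h : ∀ v : HeightOneSpectrum (𝓞 K), v.asIdeal ∣ I → f v = g v) :
    artinSymbol f I = artinSymbol g I := by
  unfold artinSymbol
  refine finprod_congr fun v ↦ ?_
  by_cases hv : (Associates.mk v.asIdeal).count (Associates.mk I).factors = 0
  · rw [hv, pow_zero, pow_zero]
  · rw [h v ((Associates.count_ne_zero_iff_dvd hI v.irreducible).mp hv)]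

omit [NumberField K] in
/-- A prime dividing an ideal `𝔞` prime to `p𝔣` does not divide `p^s𝔣` (`𝔮 ⊉ p^s𝔣`).
[cite: Kato2004Asterisque, §15.6 (p. 254)] -/
theorem not_katoModulus_le_of_dvd_of_isCoprime {𝔞 : Ideal (𝓞 K)}
    (h𝔞 : IsCoprime 𝔞 (katoModulus p 𝔣 1)) {v : HeightOneSpectrum (𝓞 K)} (hv : v.asIdeal ∣ 𝔞) (s : ℕ) :
    ¬ katoModulus p 𝔣 s ≤ v.asIdeal := by
  intro hle
  haveI := v.isPrime
  have h1 : 𝔞 ≤ v.asIdeal := Ideal.le_of_dvd hv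
  -- `p^s 𝔣 ≤ 𝔮` forces `(p) ≤ 𝔮` or `𝔣 ≤ 𝔮`, hence `p𝔣 ≤ 𝔮`
  have h2 : katoModulus p 𝔣 1 ≤ v.asIdeal := by
    rw [katoModulus] at hle
    rw [katoModulus_one]
    rcases v.isPrime.mul_le.mp hle with h | h
    · exact Ideal.mul_le_right.trans (Ideal.IsPrime.le_of_pow_le h)
    · exact Ideal.mul_le_left.trans h
  have h3 : (⊤ : Ideal (𝓞 K)) ≤ v.asIdeal := by
    rw [← Ideal.isCoprime_iff_sup_eq.mp h𝔞]
    exact sup_le h1 h2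
  exact v.isPrime.ne_top (top_le_iff.mp h3)

/-- A rational prime is not a unit of `𝓞_K` (its norm is `p^{[K:ℚ]} ≠ ±1`; the tree's
`not_isUnit_natCast_of_prime` of `CongruenceSubgroupPropertySL2UnitOrders`, re-proved to keep imports light).
[cite: NeukirchANT1999, Ch. I §2] -/
private theorem not_isUnit_natCast_of_prime' {l : ℕ} (hl : l.Prime) : ¬ IsUnit ((l : ℕ) : 𝓞 K) := by
  intro hu
  have h1 : IsUnit (Algebra.norm ℤ ((l : ℕ) : 𝓞 K)) := hu.map _
  have h2 : Algebra.norm ℤ ((l : ℕ) : 𝓞 K) = (l : ℤ) ^ Module.finrank ℤ (𝓞 K) := by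
    rw [show ((l : ℕ) : 𝓞 K) = algebraMap ℤ (𝓞 K) (l : ℤ) by simp, Algebra.norm_algebraMap]
  rw [h2] at h1
  have hpos : 0 < Module.finrank ℤ (𝓞 K) := Module.finrank_pos
  rcases Int.isUnit_iff.mp h1 with h | h
  · have : (l : ℤ) ^ Module.finrank ℤ (𝓞 K) ≥ 2 ^ 1 := by
      calc (l : ℤ) ^ Module.finrank ℤ (𝓞 K) ≥ 2 ^ Module.finrank ℤ (𝓞 K) := by
            gcongr; exact_mod_cast hl.two_le
        _ ≥ 2 ^ 1 := pow_le_pow_right₀ (by norm_num) hpos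
    omega
  · have : (0 : ℤ) ≤ (l : ℤ) ^ Module.finrank ℤ (𝓞 K) := by positivity
    omega

/-- An ideal prime to `p𝔣` is non-zero (`p𝔣 ≠ 𝓞_K`). [cite: Kato2004Asterisque, §15.6 (p. 254)] -/
theorem ne_bot_of_isCoprime_katoModulus [Fact p.Prime] {𝔞 : Ideal (𝓞 K)}
    (h𝔞 : IsCoprime 𝔞 (katoModulus p 𝔣 1)) : 𝔞 ≠ ⊥ := by
  rintro rfl
  have h1 : katoModulus p 𝔣 1 = ⊤ := by
    simpa [Ideal.isCoprime_iff_sup_eq] using h𝔞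
  have h2 : katoModulus p 𝔣 1 ≤ Ideal.span {((p : ℕ) : 𝓞 K)} := by
    rw [katoModulus_one]
    exact Ideal.mul_le_right
  rw [h1, top_le_iff, Ideal.span_singleton_eq_top] at h2
  exact not_isUnit_natCast_of_prime' (Fact.out : p.Prime) h2

/-- An admissible twist `𝔞` (prime to `6p𝔣`) is prime to `p𝔣`. [cite: Kato2004Asterisque, §15.6 (p. 254)] -/
theorem IsTwist.isCoprime_katoModulus_one {𝔞 : Ideal (𝓞 K)} (h : IsTwist p 𝔣 𝔞) :
    IsCoprime 𝔞 (katoModulus p 𝔣 1) := by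
  refine IsCoprime.of_isCoprime_of_dvd_right h.isCoprime ?_
  rw [katoModulus_one, katoModulus6, Ideal.dvd_iff_le]
  refine Ideal.mul_mono_left (Ideal.span_singleton_le_span_singleton.mpr ?_)
  refine Dvd.intro ((6 : ℕ) : 𝓞 K) ?_
  push_cast
  ring

section TwoFields

variable {E E' : IntermediateField K (AlgebraicClosure K)}

omit [NumberField K] in
/-- For intermediate fields `E ≤ E′` of `K̄/K`, with `E′` an `E`-algebra through the inclusion, `K → E → E′`
is a scalar tower (stated once for ABSTRACT intermediate fields, where the kernel check of the defining
`rfl` is cheap). [cite: NeukirchANT1999, Ch. IV §1] -/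
private theorem isScalarTower_inclusion' (h : E ≤ E') :
    letI := (IntermediateField.inclusion h).toRingHom.toAlgebra
    IsScalarTower K E E' :=
  letI := (IntermediateField.inclusion h).toRingHom.toAlgebra
  IsScalarTower.of_algebraMap_eq fun _ ↦ rfl

/-- **Frobenius restricts to Frobenius along `E ⊆ E′`** (finite Galois subextensions of `K̄/K`, `E` abelian
and unramified at `𝔮`): `Frob_𝔮^{E′}(x) = Frob_𝔮^{E}(x)` for `x ∈ E`, read in `K̄` (Childress Ch. 5 §1
Cor. 1.2 "`(𝔭, K/F)|_L = (𝔭, L/F)`", the tree's `restrictNormalHom_galFrob_eq_galFrob_of_isUnramifiedIn`).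
[cite: Childress2009, Ch. 5 §1 Cor. 1.2 (PDF p. 115)] [cite: NeukirchANT1999, Ch. VI §7 (7.3)] -/
theorem coe_galFrob_inclusion_eq (h : E ≤ E') [NumberField E] [NumberField E'] [IsAbelianGalois K E]
    [IsGalois K E'] {v : HeightOneSpectrum (𝓞 K)} (hv : Algebra.IsUnramifiedIn (𝓞 E) v.asIdeal) (x : E) :
    ((galFrob K E' v (IntermediateField.inclusion h x) : E') : AlgebraicClosure K) =
      ((galFrob K E v x : E) : AlgebraicClosure K) := by
  letI : Algebra E E' := (IntermediateField.inclusion h).toRingHom.toAlgebra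
  haveI : IsScalarTower K E E' := isScalarTower_inclusion' h
  have hres : AlgEquiv.restrictNormalHom (K₁ := E') E (galFrob K E' v) = galFrob K E v :=
    restrictNormalHom_galFrob_eq_galFrob_of_isUnramifiedIn (commute_of_isAbelianGalois _) hv
  have hcomm : IntermediateField.inclusion h ((galFrob K E' v).restrictNormal E x) =
      galFrob K E' v (IntermediateField.inclusion h x) :=
    AlgEquiv.restrictNormal_commutes (galFrob K E' v) E x
  rw [← hcomm, IntermediateField.coe_inclusion]
  change (((AlgEquiv.restrictNormalHom (K₁ := E') E (galFrob K E' v)) x : E) : AlgebraicClosure K) = _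
  rw [hres]

/-- **The Artin symbol of `E′` restricts to that of `E`** along `E ⊆ E′` (finite ABELIAN subextensions of
`K̄/K`) for `𝔞 ≠ 0` all of whose prime factors are unramified in `E`: `(𝔞, E′/K)(x) = (𝔞, E/K)(x)` for
`x ∈ E`, read in `K̄` (the Galois groups carry the `CommGroup` structure of the tree's
`commGroup_gal_rayClassField`, spelled out for abstract `E`, `E′`).
[cite: Childress2009, Ch. 5 §1 Cor. 1.2 (PDF p. 115)] [cite: NeukirchANT1999, Ch. VI §7 (7.3)] -/
theorem coe_artinSymbol_galFrob_inclusion_eq (h : E ≤ E') [NumberField E] [NumberField E']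
    [IsAbelianGalois K E] [IsAbelianGalois K E'] {𝔞 : Ideal (𝓞 K)} (h0 : 𝔞 ≠ ⊥)
    (h𝔞 : ∀ v : HeightOneSpectrum (𝓞 K), v.asIdeal ∣ 𝔞 → Algebra.IsUnramifiedIn (𝓞 E) v.asIdeal) (x : E) :
    letI : CommGroup (E ≃ₐ[K] E) :=
      { (inferInstance : Group (E ≃ₐ[K] E)) with mul_comm := IsMulCommutative.is_comm.comm }
    letI : CommGroup (E' ≃ₐ[K] E') :=
      { (inferInstance : Group (E' ≃ₐ[K] E')) with mul_comm := IsMulCommutative.is_comm.comm }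
    ((artinSymbol (galFrob K E') 𝔞 (IntermediateField.inclusion h x) : E') : AlgebraicClosure K) =
      ((artinSymbol (galFrob K E) 𝔞 x : E) : AlgebraicClosure K) := by
  letI : CommGroup (E ≃ₐ[K] E) :=
    { (inferInstance : Group (E ≃ₐ[K] E)) with mul_comm := IsMulCommutative.is_comm.comm }
  letI : CommGroup (E' ≃ₐ[K] E') :=
    { (inferInstance : Group (E' ≃ₐ[K] E')) with mul_comm := IsMulCommutative.is_comm.comm }
  letI : Algebra E E' := (IntermediateField.inclusion h).toRingHom.toAlgebra
  haveI : IsScalarTower K E E' := isScalarTower_inclusion' h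
  set r := AlgEquiv.restrictNormalHom (F := K) (K₁ := E') E with hr
  have hres : ∀ v : HeightOneSpectrum (𝓞 K), v.asIdeal ∣ 𝔞 → (r ∘ galFrob K E') v = galFrob K E v :=
    fun v hv ↦ restrictNormalHom_galFrob_eq_galFrob_of_isUnramifiedIn (commute_of_isAbelianGalois _) (h𝔞 v hv)
  have hmap : r (artinSymbol (galFrob K E') 𝔞) = artinSymbol (galFrob K E) 𝔞 := by
    rw [map_artinSymbol r _ h0, artinSymbol_congr_of_dvd h0 hres]
  have hcomm : IntermediateField.inclusion h ((artinSymbol (galFrob K E') 𝔞).restrictNormal E x) =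
      artinSymbol (galFrob K E') 𝔞 (IntermediateField.inclusion h x) :=
    AlgEquiv.restrictNormal_commutes (artinSymbol (galFrob K E') 𝔞) E x
  rw [← hcomm, IntermediateField.coe_inclusion]
  change (((r (artinSymbol (galFrob K E') 𝔞)) x : E) : AlgebraicClosure K) = _
  rw [hmap]

end TwoFields

section TwoLayers

variable [Fact p.Prime] {p 𝔣}

/-- **`(layerArtin p 𝔣 s′ 𝔞)|_{K(p^s𝔣)} = (𝔞, K(p^s𝔣)/K)` for `s ≤ s′`** and `𝔞` prime to `p𝔣`: Kato's
lifted Artin symbols form a compatible system ("`(𝔞, K(p^∞𝔣)/K) ∈ G_{p^∞𝔣}`"; every `𝔮 ∣ 𝔞` is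
unramified in the ray class field `K(p^s𝔣)` of a modulus it does not divide).
[cite: Kato2004Asterisque, §15.6 (p. 254)] [cite: Childress2009, Ch. 5 §1 Cor. 1.2 (PDF p. 115)] -/
theorem absRestrictNormalHom_layerArtin_of_le {s s' : ℕ} (hss : s ≤ s') (h𝔣 : 𝔣 ≠ ⊥) {𝔞 : Ideal (𝓞 K)}
    (h𝔞 : IsCoprime 𝔞 (katoModulus p 𝔣 1)) :
    absRestrictNormalHom (katoLayer p 𝔣 s) (layerArtin p 𝔣 s' 𝔞) =
      artinSymbol (galFrob K (katoLayer p 𝔣 s)) 𝔞 := by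
  refine AlgEquiv.ext fun x ↦ Subtype.ext ?_
  have h1 : ((absRestrictNormalHom (katoLayer p 𝔣 s) (layerArtin p 𝔣 s' 𝔞) x : katoLayer p 𝔣 s) :
      AlgebraicClosure K) = layerArtin p 𝔣 s' 𝔞 • (x : AlgebraicClosure K) :=
    AlgEquiv.restrictNormalHom_apply _ _ x
  have h2 : layerArtin p 𝔣 s' 𝔞 • ((IntermediateField.inclusion (katoLayer_mono p 𝔣 h𝔣 hss) x :
      katoLayer p 𝔣 s') : AlgebraicClosure K) = _ := layerLift_smul p 𝔣 s' _ _
  rw [IntermediateField.coe_inclusion] at h2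
  rw [h1, h2]
  exact coe_artinSymbol_galFrob_inclusion_eq (katoLayer_mono p 𝔣 h𝔣 hss)
    (ne_bot_of_isCoprime_katoModulus p 𝔣 h𝔞)
    (fun v hv ↦ isUnramifiedIn_rayClassField (katoModulus_ne_bot p 𝔣 h𝔣 s)
      (not_katoModulus_le_of_dvd_of_isCoprime p 𝔣 h𝔞 hv s)) x

/-- **COMPATIBILITY OF KATO'S LIFTS: `(layerArtin p 𝔣 s 𝔞)⁻¹ · layerArtin p 𝔣 s′ 𝔞 ∈ Gal(K̄/K(p^s𝔣))`**
for `s ≤ s′` and `𝔞` prime to `p𝔣` — the two lifts agree on `K(p^s𝔣)`.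
[cite: Kato2004Asterisque, §15.6 (p. 254)] [cite: JohnsonLeungKings2011, §5.1 (arXiv p0014:L12–14)] -/
theorem layerArtin_inv_mul_layerArtin_mem {s s' : ℕ} (hss : s ≤ s') (h𝔣 : 𝔣 ≠ ⊥) {𝔞 : Ideal (𝓞 K)}
    (h𝔞 : IsCoprime 𝔞 (katoModulus p 𝔣 1)) :
    (layerArtin p 𝔣 s 𝔞)⁻¹ * layerArtin p 𝔣 s' 𝔞 ∈ JohnsonLeungKings2011.katoLevelSubgroup p 𝔣 s := by
  change _ ∈ (MonoidHom.ker _)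
  rw [MonoidHom.mem_ker, map_mul, map_inv]
  change (absRestrictNormalHom (katoLayer p 𝔣 s) (layerArtin p 𝔣 s 𝔞))⁻¹ *
      absRestrictNormalHom (katoLayer p 𝔣 s) (layerArtin p 𝔣 s' 𝔞) = 1
  rw [absRestrictNormalHom_layerArtin_self, absRestrictNormalHom_layerArtin_of_le hss h𝔣 h𝔞, inv_mul_cancel]

/-- The same for admissible twists `𝔞` (prime to `6p𝔣`), the index set of Kato's `ℨ` / JLK's `AuxIdeals`.
[cite: Kato2004Asterisque, §15.6 (p. 254)] [cite: JohnsonLeungKings2011, §5.1 (arXiv p0014:L12–14)] -/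
theorem layerArtin_inv_mul_layerArtin_mem_of_isTwist {s s' : ℕ} (hss : s ≤ s') (h𝔣 : 𝔣 ≠ ⊥)
    {𝔞 : Ideal (𝓞 K)} (h𝔞 : IsTwist p 𝔣 𝔞) :
    (layerArtin p 𝔣 s 𝔞)⁻¹ * layerArtin p 𝔣 s' 𝔞 ∈ JohnsonLeungKings2011.katoLevelSubgroup p 𝔣 s :=
  layerArtin_inv_mul_layerArtin_mem hss h𝔣 (IsTwist.isCoprime_katoModulus_one p 𝔣 h𝔞)

end TwoLayers


end Literature.NumberTheory.ComplexMultiplication.EllipticUnits
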